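import Literature.MathematicalPhysics.KineticTheory.LinearisedPhononCollisionOperator
import Literature.MathematicalPhysics.KineticTheory.HarmonicChainFlux
import Mathlib.Analysis.SpecialFunctions.Integrals.Basic
import Mathlib.Analysis.SpecialFunctions.Trigonometric.ArctanDeriv
import Mathlib.MeasureTheory.Integral.IntervalIntegral.FundThmCalculus
import HarnessLib

/-!
# The end-site albedo of the Rieder–Lebowitz–Lieb chain and its Landauer identity

Topic `Literature/MathematicalPhysics/KineticTheory` (definition request `defn-EndSiteAlbedo`, wanted
by route ResistanceOnset: cruxes KineticWindowResistance / OnsetKinetic, and by the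
kinetic-slab-with-contacts mechanism).

THE OBJECT. Take the semi-infinite pinned HARMONIC chain `pinnedChain ω₂ 0 0 γ` of
`FouriersLaw.lean` (sites `j ≥ 0`, unit masses, coupling `V(r) = r²/2`, pinning `ω₂ q²/2`, free end)
with a Langevin thermostat of friction `γ` at the end site `j = 0`:

  `q̈_j = -ω₂ q_j + (q_{j+1} - 2 q_j + q_{j-1})`                 (`j ≥ 1`),
  `q̈_0 = -ω₂ q_0 + (q_1 - q_0) - γ q̇_0 + √(2γT) Ẇ`.

A band phonon has `ω(k)² = ω₂ + 2(1 - cos k)` (`PhononBoltzmann.dispersion`), group velocity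
`ω'(k) = sin k/ω(k)` (`groupVelocity`). For `k ∈ (0, π)` the wave `e^{-i(kj + ωt)}` runs INTO the
end; the stationary scattering solution of the noiseless equations is
`q_j(t) = (e^{-ikj} + B e^{ikj}) e^{-iωt}`: the bulk equation holds for every plane wave on the band,
and the end equation `-ω² q_0 = -ω₂ q_0 + (q_1 - q_0) + iγω q_0` fixes the REFLECTION AMPLITUDE

  `B = endReflection ω₂ γ k = -((e^{ik} - 1) - iγω)/((e^{-ik} - 1) - iγω)`

(`scatteringMode_bulk`, `scatteringMode_end`). Incident and reflected waves carry energy flux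
`∝ |ω'| ω² |amplitude|²`, so the fraction of the incident flux dissipated into the bath — the
ABSORPTION PROBABILITY, and by Kirchhoff/detailed balance the EMISSIVITY of the thermostat into
mode `k` — is `1 - |B|²`:

  `α_γ(k) = endSiteAlbedo ω₂ γ k = 4γω(k)|sin k| / ((1 - cos k)² + (|sin k| + γω(k))²) ∈ [0, 1)`

(`endSiteAlbedo_eq_one_sub_normSq` on `sin k ≥ 0`; written with `|sin k|` it is the even,
`2π`-periodic function giving the albedo of whichever of `±k` is incident). This is the grey-wall
datum `αL = αR = α_γ` of `KineticMedium.IsSlabSolution` (`KineticSlabConductance.lean`) and the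
`albedo` field of `MilneData` (`MilneExtrapolationLength.lean`) for a Langevin END site: the
`p₊ = 0` member of the Komorowski–Olla family of thermostat interface coefficients (transmission
`p₊`, reflection `p₋`, absorption `𝔤`, `p₊ + p₋ + 𝔤 = 1`, Komorowski–Olla 2020 §2.6), here with
`p₋ = |B|² = 1 - α_γ`.

THE LANDAUER IDENTITY (the content of this file). Two grey walls of albedo `α` facing each other
across a collisionless slab transmit the fraction `1/(1/α + 1/α - 1) = α/(2 - α)` of the black-body
flux (`twoStreamMedium.kineticSlabConductance_of_eq` of `KineticSlabConductance.lean`), so the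
conductance of the harmonic chain between two Langevin ends, in the incoherent (`N → ∞`) limit, is

  `(2π)⁻¹ ∫₀^π ω'(k) · α_γ(k)/(2 - α_γ(k)) dk = (γ/π) ∫₀^π sin²k dk / (2(1+γ²)(1 - cos k) + γ²ω₂)`

(`groupVelocity_mul_transmission`), which is LITERALLY Roy–Dhar's `N → ∞` current formula
[RoyDhar2008, §2 eq. (2.6)] `J = (γk²k_BΔT/πm) ∫₀^π sin²q dq/(Λ - Ω cos q)` at `m = k = 1`, `k' = 0`
(free ends), `k_o = ω₂` (`Λ = 2 + (ω₂+2)γ²`, `Ω = 2(1+γ²)`), and we PROVE (`landauer_endSiteAlbedo`)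
that it equals the ballistic constant `fluxLimit ω₂ γ = γ r/(2(1+γ²))` of `HarmonicChainFlux.lean`
— the proved `N → ∞` limit of the flux per unit temperature difference of `pinnedChain ω₂ 0 0 γ`
(`tendsto_fluxCoeff`; Roy–Dhar (2.8), Nakazawa's case). The computation is Roy–Dhar's second line
of (2.6), `∫₀^π sin²q dq/(Λ - Ω cos q) = (π/Ω²)(Λ - √(Λ² - Ω²))` (`integral_sin_sq_div_sub_mul_cos`),
reduced to the Poisson-type integral `∫₀^π sin²k dk/(1 - 2r cos k + r²) = π/2` (`|r| < 1`,
`integral_sin_sq_div_poisson`, by an explicit primitive).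

## Contents

* `endReflection`, `scatteringMode`, `scatteringMode_bulk`, `scatteringMode_end` — the derivation.
* `endSiteAlbedo` (the requested `ℝ → ℝ`, closed form) and its API: `_def`, `_eq` (expanded
  denominator), `_neg`, `_periodic`, `_add_two_pi`, `_nonneg`, `_le_one`, `_lt_one`, `_pos`,
  `_pos_iff`, `_zero`, `_pi`, `continuous_endSiteAlbedo`, `endSiteAlbedo_eq_one_sub_normSq`
  (`= 1 - |B|²`), `endSiteAlbedo_mul_sin_eq_dissipation` (`α sin k = γω|q_0|²`, energy balance).
* `transmission_eq` (`α/(2-α) = 2γω|sin k|/(2(1 - cos k) + γ²ω²)`),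
  `groupVelocity_mul_transmission`, `integral_sin_sq_div_poisson`,
  `integral_sin_sq_div_sub_mul_cos`, `landauer_endSiteAlbedo`.

Not here: the instantiated `KineticMedium`/`MilneData` of the window (route business), the
band-edge asymptotics `α_γ ∼ c |ω'|`, and any claim about the anharmonic chain.

## References

* D. Roy, A. Dhar, *Heat transport in ordered harmonic lattices*, J. Stat. Phys. 131 (2008)
  535–541 (arXiv:0711.4318), §2 eqs. (2.2)–(2.8) (materialised and read: (2.6) is the integral
  above, (2.8) the free-end value). [cite: RoyDhar2008, §2 eqs. (2.6), (2.8)]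
* Z. Rieder, J. L. Lebowitz, E. Lieb, J. Math. Phys. 8 (1967) 1073–1078; H. Nakazawa, Progr.
  Theoret. Phys. Suppl. 45 (1970) 231–262 (the chain and its ballistic flux).
  [cite: RiederLebowitzLieb1967, main result (ii)]
* T. Komorowski, S. Olla, *Kinetic limit for a chain of harmonic oscillators with a point Langevin
  thermostat*, J. Funct. Anal. 279 (2020) 108764, §1 (interface conditions) and §2.6 (the
  coefficients `p₊, p₋, 𝔤`, `p₊ + p₋ + 𝔤 = 1`). [cite: KomorowskiOlla2020, §2.6]
* A. Dhar, *Heat transport in low-dimensional systems*, Adv. Phys. 57 (2008) 457–537, §3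
  (Langevin equations and Green's function formula for harmonic lattices). [cite: Dhar2008, §3]
-/

noncomputable section

open Real MeasureTheory intervalIntegral

namespace Literature.MathematicalPhysics.KineticTheory.PhononBoltzmann

open HeatConduction

section Scattering

open Complex

/-! ### The scattering of a band phonon off the thermostatted end -/

/-- The REFLECTION AMPLITUDE of the Langevin end site of `pinnedChain ω₂ 0 0 γ` for the band
phonon `k`: `B = -((e^{ik} - 1) - iγω(k))/((e^{-ik} - 1) - iγω(k))`, written in real and
imaginary parts (`e^{±ik} - 1 - iγω = (cos k - 1) + i(±sin k - γω)`; see `endReflection_eq_exp`).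
It is the unique `B` for which `e^{-ikj} + B e^{ikj}` solves the end equation
(`scatteringMode_end`). [folklore] -/
def endReflection (ω₂ γ k : ℝ) : ℂ :=
  -(⟨Real.cos k - 1, Real.sin k - γ * dispersion ω₂ k⟩ : ℂ) /
    ⟨Real.cos k - 1, -Real.sin k - γ * dispersion ω₂ k⟩

/-- The stationary SCATTERING MODE `q_j = e^{-ikj} + B e^{ikj}` (`j ∈ ℤ`; the chain occupies
`j ≥ 0`): unit incident amplitude on the left-moving wave, reflected amplitude
`B = endReflection ω₂ γ k`. [folklore] -/
def scatteringMode (ω₂ γ k : ℝ) (j : ℤ) : ℂ :=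
  cexp (-(I * k * j)) + endReflection ω₂ γ k * cexp (I * k * j)

/-- `e^{ik} - 1 - iγω = ⟨cos k - 1, sin k - γω⟩`. [folklore] -/
theorem exp_sub_one_sub_eq (ω₂ γ k : ℝ) :
    cexp (I * k) - 1 - I * (γ * dispersion ω₂ k) =
      (⟨Real.cos k - 1, Real.sin k - γ * dispersion ω₂ k⟩ : ℂ) := by
  apply Complex.ext
  · simp [Complex.exp_re]
  · simp [Complex.exp_im]

/-- `e^{-ik} - 1 - iγω = ⟨cos k - 1, -sin k - γω⟩`. [folklore] -/
theorem exp_neg_sub_one_sub_eq (ω₂ γ k : ℝ) :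
    cexp (-(I * k)) - 1 - I * (γ * dispersion ω₂ k) =
      (⟨Real.cos k - 1, -Real.sin k - γ * dispersion ω₂ k⟩ : ℂ) := by
  apply Complex.ext
  · simp [Complex.exp_re]
  · simp [Complex.exp_im]

/-- The exponential form `B = -((e^{ik} - 1) - iγω)/((e^{-ik} - 1) - iγω)`. [folklore] -/
theorem endReflection_eq_exp (ω₂ γ k : ℝ) :
    endReflection ω₂ γ k =
      -(cexp (I * k) - 1 - I * (γ * dispersion ω₂ k)) /
        (cexp (-(I * k)) - 1 - I * (γ * dispersion ω₂ k)) := by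
  rw [exp_sub_one_sub_eq, exp_neg_sub_one_sub_eq, endReflection]

/-- The denominator `(cos k - 1)² + (sin k + γω)²` of `|B|²` vanishes only if `sin k = 0` and
`γω = 0`; in particular it is positive for `ω₂ > 0`, `γ > 0`. [folklore] -/
theorem normSq_den_pos {ω₂ γ : ℝ} (hω : 0 < ω₂) (hγ : 0 < γ) (k : ℝ) :
    0 < (Real.cos k - 1) ^ 2 + (-Real.sin k - γ * dispersion ω₂ k) ^ 2 := by
  have hωk := dispersion_pos hω k
  rcases eq_or_ne (Real.cos k) 1 with hc | hc
  · have hs : Real.sin k = 0 := by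
      have h := Real.sin_sq_add_cos_sq k
      rw [hc] at h
      have h2 : Real.sin k ^ 2 = 0 := by linarith
      exact (pow_eq_zero_iff two_ne_zero).1 h2
    have hpos : 0 < γ * dispersion ω₂ k := mul_pos hγ hωk
    rw [hs, hc]
    nlinarith
  · have h1 : 0 < (Real.cos k - 1) ^ 2 := by
      have : Real.cos k - 1 ≠ 0 := sub_ne_zero.2 hc
      positivity
    nlinarith [sq_nonneg (-Real.sin k - γ * dispersion ω₂ k)]

/-- The denominator of `B` is non-zero for `ω₂ > 0`, `γ > 0`. [folklore] -/
theorem endReflection_den_ne_zero {ω₂ γ : ℝ} (hω : 0 < ω₂) (hγ : 0 < γ) (k : ℝ) :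
    (⟨Real.cos k - 1, -Real.sin k - γ * dispersion ω₂ k⟩ : ℂ) ≠ 0 := by
  intro h
  have := normSq_den_pos hω hγ k
  have h0 : Complex.normSq (⟨Real.cos k - 1, -Real.sin k - γ * dispersion ω₂ k⟩ : ℂ) = 0 := by
    rw [h, map_zero]
  rw [Complex.normSq_mk] at h0
  nlinarith

/-- **Bulk equation.** Every combination of the two band plane waves solves
`-ω(k)² q_j = -ω₂ q_j + (q_{j+1} - 2q_j + q_{j-1})` at every site (`ω₂ ≥ 0`). [folklore] -/
theorem scatteringMode_bulk {ω₂ : ℝ} (hω : 0 ≤ ω₂) (γ k : ℝ) (j : ℤ) :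
    -((dispersion ω₂ k : ℂ) ^ 2) * scatteringMode ω₂ γ k j =
      -(ω₂ : ℂ) * scatteringMode ω₂ γ k j +
        (scatteringMode ω₂ γ k (j + 1) - 2 * scatteringMode ω₂ γ k j +
          scatteringMode ω₂ γ k (j - 1)) := by
  have hdisp : ((dispersion ω₂ k : ℂ)) ^ 2 = (ω₂ : ℂ) + 2 - (cexp (I * k) + cexp (-(I * k))) := by
    have h1 : ((dispersion ω₂ k : ℝ) : ℂ) ^ 2 = ((ω₂ + 2 * (1 - Real.cos k) : ℝ) : ℂ) := by
      rw [← Complex.ofReal_pow, dispersion_sq hω]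
    rw [h1]
    have h2 : cexp (I * k) + cexp (-(I * k)) = 2 * Complex.cos k := by
      rw [Complex.cos, show -(I * (k : ℂ)) = -(k : ℂ) * I by ring, show I * (k : ℂ) = k * I by ring]
      ring
    rw [h2, ← Complex.ofReal_cos]
    push_cast
    ring
  set B := endReflection ω₂ γ k
  have e1 : cexp (I * k * ((j + 1 : ℤ) : ℂ)) = cexp (I * k * j) * cexp (I * k) := by
    rw [← Complex.exp_add]; congr 1; push_cast; ring
  have e2 : cexp (I * k * ((j - 1 : ℤ) : ℂ)) = cexp (I * k * j) * cexp (-(I * k)) := by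
    rw [← Complex.exp_add]; congr 1; push_cast; ring
  have e3 : cexp (-(I * k * ((j + 1 : ℤ) : ℂ))) = cexp (-(I * k * j)) * cexp (-(I * k)) := by
    rw [← Complex.exp_add]; congr 1; push_cast; ring
  have e4 : cexp (-(I * k * ((j - 1 : ℤ) : ℂ))) = cexp (-(I * k * j)) * cexp (I * k) := by
    rw [← Complex.exp_add]; congr 1; push_cast; ring
  simp only [scatteringMode]
  rw [e1, e2, e3, e4, hdisp]
  ring

/-- **End equation.** For `ω₂ > 0`, `γ > 0` the scattering mode solves the equation of the
thermostatted end site `j = 0` at frequency `ω = ω(k)`: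
`-ω² q_0 = -ω₂ q_0 + (q_1 - q_0) + iγω q_0` (friction `-γ q̇_0 = iγω q_0` on `e^{-iωt}`).
[folklore] -/
theorem scatteringMode_end {ω₂ γ : ℝ} (hω : 0 < ω₂) (hγ : 0 < γ) (k : ℝ) :
    -((dispersion ω₂ k : ℂ) ^ 2) * scatteringMode ω₂ γ k 0 =
      -(ω₂ : ℂ) * scatteringMode ω₂ γ k 0 +
        (scatteringMode ω₂ γ k 1 - scatteringMode ω₂ γ k 0) +
          I * (γ * dispersion ω₂ k) * scatteringMode ω₂ γ k 0 := by
  -- the bulk equation at `j = 0` reduces the claim to `q_{-1} = (1 + iγω) q_0`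
  have hb := scatteringMode_bulk hω.le γ k 0
  simp only [zero_add, zero_sub] at hb
  rw [hb]
  have hden := endReflection_den_ne_zero hω hγ k
  have key : scatteringMode ω₂ γ k (-1) =
      (1 + I * (γ * dispersion ω₂ k)) * scatteringMode ω₂ γ k 0 := by
    have hB : endReflection ω₂ γ k * (cexp (-(I * k)) - 1 - I * (γ * dispersion ω₂ k)) =
        -(cexp (I * k) - 1 - I * (γ * dispersion ω₂ k)) := by
      rw [endReflection_eq_exp, neg_div, neg_mul, div_mul_cancel₀]
      rwa [exp_neg_sub_one_sub_eq]
    simp only [scatteringMode, Int.cast_neg, Int.cast_one, Int.cast_zero, mul_zero, neg_zero,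
      Complex.exp_zero, mul_one, mul_neg, neg_neg]
    linear_combination hB
  rw [key]
  ring

end Scattering

/-! ### The albedo -/

/-- The **end-site albedo** of the Rieder–Lebowitz–Lieb chain `pinnedChain ω₂ 0 0 γ`: the
probability `α_γ(k) = 4γω(k)|sin k| / ((1 - cos k)² + (|sin k| + γω(k))²)` that a band phonon of
wavenumber `k` incident on the Langevin end site is absorbed by the bath (`= 1 - |B|²`,
`endSiteAlbedo_eq_one_sub_normSq`); by Kirchhoff also the emissivity of the thermostat into mode
`k`. Even and `2π`-periodic in `k` (the albedo of whichever of `±k` is incident), with values in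
`[0, 1)`; `ω = dispersion ω₂`. Junk: for parameters where the denominator vanishes (only if
`sin k = 0` and `γω(k) = 0`) the value is `0`. [folklore] -/
def endSiteAlbedo (ω₂ γ : ℝ) (k : ℝ) : ℝ :=
  4 * γ * dispersion ω₂ k * |Real.sin k| /
    ((1 - Real.cos k) ^ 2 + (|Real.sin k| + γ * dispersion ω₂ k) ^ 2)

/-- The defining closed form (literally the expression inlined in route ResistanceOnset).
[folklore] -/
theorem endSiteAlbedo_def (ω₂ γ k : ℝ) :
    endSiteAlbedo ω₂ γ k = 4 * γ * dispersion ω₂ k * |Real.sin k| /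
      ((1 - Real.cos k) ^ 2 + (|Real.sin k| + γ * dispersion ω₂ k) ^ 2) := rfl

/-- The denominator expanded: `(1 - cos k)² + (|sin k| + γω)² = 2(1 - cos k) + 2γω|sin k| + γ²ω²`.
[folklore] -/
theorem endSiteAlbedo_den_eq (ω₂ γ k : ℝ) :
    (1 - Real.cos k) ^ 2 + (|Real.sin k| + γ * dispersion ω₂ k) ^ 2 =
      2 * (1 - Real.cos k) + 2 * γ * dispersion ω₂ k * |Real.sin k| +
        γ ^ 2 * dispersion ω₂ k ^ 2 := by
  have h := Real.sin_sq_add_cos_sq k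
  have ha : |Real.sin k| ^ 2 = Real.sin k ^ 2 := sq_abs _
  nlinarith [ha]

/-- `α_γ(k) = 4γω|sin k| / (2(1 - cos k) + 2γω|sin k| + γ²ω²)`. [folklore] -/
theorem endSiteAlbedo_eq (ω₂ γ k : ℝ) :
    endSiteAlbedo ω₂ γ k = 4 * γ * dispersion ω₂ k * |Real.sin k| /
      (2 * (1 - Real.cos k) + 2 * γ * dispersion ω₂ k * |Real.sin k| +
        γ ^ 2 * dispersion ω₂ k ^ 2) := by
  rw [endSiteAlbedo, endSiteAlbedo_den_eq]

/-- The denominator is positive for `ω₂ > 0`, `γ > 0`. [folklore] -/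
theorem endSiteAlbedo_den_pos {ω₂ γ : ℝ} (hω : 0 < ω₂) (hγ : 0 < γ) (k : ℝ) :
    0 < (1 - Real.cos k) ^ 2 + (|Real.sin k| + γ * dispersion ω₂ k) ^ 2 := by
  have hωk := dispersion_pos hω k
  have : 0 < |Real.sin k| + γ * dispersion ω₂ k := by positivity
  positivity

/-- `α_γ` is even. [folklore] -/
theorem endSiteAlbedo_neg (ω₂ γ k : ℝ) : endSiteAlbedo ω₂ γ (-k) = endSiteAlbedo ω₂ γ k := by
  simp [endSiteAlbedo, dispersion_neg, Real.sin_neg, Real.cos_neg, abs_neg]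

/-- `α_γ` is `2π`-periodic. [folklore] -/
theorem endSiteAlbedo_periodic (ω₂ γ : ℝ) : Function.Periodic (endSiteAlbedo ω₂ γ) (2 * π) := by
  intro k
  simp [endSiteAlbedo, dispersion_periodic ω₂ k, Real.sin_add_two_pi, Real.cos_add_two_pi]

/-- `α_γ(k + 2π) = α_γ(k)`. [folklore] -/
theorem endSiteAlbedo_add_two_pi (ω₂ γ k : ℝ) :
    endSiteAlbedo ω₂ γ (k + 2 * π) = endSiteAlbedo ω₂ γ k :=
  endSiteAlbedo_periodic ω₂ γ k

/-- `0 ≤ α_γ` for `γ ≥ 0`. [folklore] -/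
theorem endSiteAlbedo_nonneg (ω₂ : ℝ) {γ : ℝ} (hγ : 0 ≤ γ) (k : ℝ) : 0 ≤ endSiteAlbedo ω₂ γ k := by
  unfold endSiteAlbedo
  have : 0 ≤ dispersion ω₂ k := Real.sqrt_nonneg _
  positivity

/-- `α_γ ≤ 1` (always: `D - 4γω|sin k| = (1 - cos k)² + (|sin k| - γω)² ≥ 0`). [folklore] -/
theorem endSiteAlbedo_le_one (ω₂ γ k : ℝ) : endSiteAlbedo ω₂ γ k ≤ 1 := by
  unfold endSiteAlbedo
  set D := (1 - Real.cos k) ^ 2 + (|Real.sin k| + γ * dispersion ω₂ k) ^ 2 with hD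
  rcases eq_or_lt_of_le (show 0 ≤ D by positivity) with h0 | hpos
  · rw [← h0, div_zero]; exact zero_le_one
  · rw [div_le_one hpos, hD]
    nlinarith [sq_nonneg (1 - Real.cos k), sq_nonneg (|Real.sin k| - γ * dispersion ω₂ k)]

/-- `α_γ < 1` for `ω₂ > 0`, `γ > 0`: the end is never impedance-matched (equality would need
`cos k = 1` and `|sin k| = γω(k) > 0`). [folklore] -/
theorem endSiteAlbedo_lt_one {ω₂ γ : ℝ} (hω : 0 < ω₂) (hγ : 0 < γ) (k : ℝ) :
    endSiteAlbedo ω₂ γ k < 1 := by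
  have hpos := endSiteAlbedo_den_pos hω hγ k
  have hωk := dispersion_pos hω k
  unfold endSiteAlbedo
  rw [div_lt_one hpos]
  -- `D - 4γω|s| = (1 - c)² + (|s| - γω)² > 0`
  have key : 0 < (1 - Real.cos k) ^ 2 + (|Real.sin k| - γ * dispersion ω₂ k) ^ 2 := by
    rcases eq_or_ne (Real.cos k) 1 with hc | hc
    · have hs : Real.sin k = 0 := by
        have h := Real.sin_sq_add_cos_sq k
        rw [hc] at h
        have h2 : Real.sin k ^ 2 = 0 := by linarith
        exact (pow_eq_zero_iff two_ne_zero).1 h2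
      have hpos : 0 < γ * dispersion ω₂ k := mul_pos hγ hωk
      rw [hs, hc, abs_zero]
      nlinarith
    · have h1 : 0 < (1 - Real.cos k) ^ 2 := by
        have : 1 - Real.cos k ≠ 0 := sub_ne_zero.2 (Ne.symm hc)
        positivity
      nlinarith [sq_nonneg (|Real.sin k| - γ * dispersion ω₂ k)]
  nlinarith [key]

/-- `α_γ(k) > 0` exactly off the band edges: iff `sin k ≠ 0` (`ω₂ > 0`, `γ > 0`). [folklore] -/
theorem endSiteAlbedo_pos_iff {ω₂ γ : ℝ} (hω : 0 < ω₂) (hγ : 0 < γ) (k : ℝ) :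
    0 < endSiteAlbedo ω₂ γ k ↔ Real.sin k ≠ 0 := by
  have hpos := endSiteAlbedo_den_pos hω hγ k
  have hωk := dispersion_pos hω k
  unfold endSiteAlbedo
  rw [div_pos_iff_of_pos_right hpos]
  constructor
  · intro h hs
    rw [hs, abs_zero, mul_zero] at h
    exact lt_irrefl _ h
  · intro hs
    have : 0 < |Real.sin k| := abs_pos.2 hs
    positivity

/-- `α_γ > 0` on the open half-band `(0, π)` (`ω₂ > 0`, `γ > 0`). [folklore] -/
theorem endSiteAlbedo_pos {ω₂ γ : ℝ} (hω : 0 < ω₂) (hγ : 0 < γ) {k : ℝ} (hk : k ∈ Set.Ioo 0 π) :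
    0 < endSiteAlbedo ω₂ γ k :=
  (endSiteAlbedo_pos_iff hω hγ k).2 (Real.sin_pos_of_mem_Ioo hk).ne'

/-- `α_γ(0) = 0` (lower band edge). [folklore] -/
theorem endSiteAlbedo_zero (ω₂ γ : ℝ) : endSiteAlbedo ω₂ γ 0 = 0 := by
  simp [endSiteAlbedo]

/-- `α_γ(π) = 0` (upper band edge). [folklore] -/
theorem endSiteAlbedo_pi (ω₂ γ : ℝ) : endSiteAlbedo ω₂ γ π = 0 := by
  simp [endSiteAlbedo]

/-- `α_γ` is continuous (`ω₂ > 0`, `γ > 0`). [folklore] -/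
theorem continuous_endSiteAlbedo {ω₂ γ : ℝ} (hω : 0 < ω₂) (hγ : 0 < γ) :
    Continuous (endSiteAlbedo ω₂ γ) := by
  have hd : Continuous (dispersion ω₂) := by
    unfold dispersion; fun_prop
  unfold endSiteAlbedo
  refine Continuous.div (by fun_prop) (by fun_prop) fun k => (endSiteAlbedo_den_pos hω hγ k).ne'

/-- **Absorption = 1 - reflection.** On the incident half-band `sin k ≥ 0` (and for `ω₂ > 0`,
`γ > 0`), `α_γ(k) = 1 - |B|²` with `B = endReflection ω₂ γ k` the reflection amplitude of the
scattering mode. [folklore] -/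
theorem endSiteAlbedo_eq_one_sub_normSq {ω₂ γ : ℝ} (hω : 0 < ω₂) (hγ : 0 < γ) {k : ℝ}
    (hk : 0 ≤ Real.sin k) :
    endSiteAlbedo ω₂ γ k = 1 - Complex.normSq (endReflection ω₂ γ k) := by
  have hden := normSq_den_pos hω hγ k
  rw [endReflection, map_div₀, Complex.normSq_neg, Complex.normSq_mk, Complex.normSq_mk]
  unfold endSiteAlbedo
  rw [abs_of_nonneg hk]
  have hD : (1 - Real.cos k) ^ 2 + (Real.sin k + γ * dispersion ω₂ k) ^ 2 =
      (Real.cos k - 1) * (Real.cos k - 1) +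
        (-Real.sin k - γ * dispersion ω₂ k) * (-Real.sin k - γ * dispersion ω₂ k) := by ring
  have hden' : (Real.cos k - 1) * (Real.cos k - 1) +
      (-Real.sin k - γ * dispersion ω₂ k) * (-Real.sin k - γ * dispersion ω₂ k) ≠ 0 := by
    rw [← hD]; nlinarith
  rw [hD]
  field_simp
  ring

/-- **Absorption = dissipation in the bath** (energy balance of the scattering mode). On the
incident half-band `sin k ≥ 0`: `α_γ(k) sin k = γ ω(k) |q_0|²`, `q_0 = scatteringMode ω₂ γ k 0`.
The unit incident wave `cos(kj + ωt)` carries the energy flux `ω'(k) · ω²/2 = ω sin k/2` into the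
end, and the friction dissipates the mean power `γ⟨q̇_0²⟩ = γω²|q_0|²/2`; their ratio is the albedo.
[folklore] -/
theorem endSiteAlbedo_mul_sin_eq_dissipation {ω₂ γ : ℝ} (hω : 0 < ω₂) (hγ : 0 < γ) {k : ℝ}
    (hk : 0 ≤ Real.sin k) :
    endSiteAlbedo ω₂ γ k * Real.sin k =
      γ * dispersion ω₂ k * Complex.normSq (scatteringMode ω₂ γ k 0) := by
  have hden := normSq_den_pos hω hγ k
  have hden0 := endReflection_den_ne_zero hω hγ k
  -- `q_0 = 1 + B = -2i sin k / ((e^{-ik} - 1) - iγω)`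
  have hq : scatteringMode ω₂ γ k 0 =
      (⟨0, -2 * Real.sin k⟩ : ℂ) / ⟨Real.cos k - 1, -Real.sin k - γ * dispersion ω₂ k⟩ := by
    simp only [scatteringMode, Int.cast_zero, mul_zero, neg_zero, Complex.exp_zero, mul_one]
    rw [endReflection, eq_div_iff hden0, add_mul, div_mul_cancel₀ _ hden0]
    apply Complex.ext
    · simp
    · simp; ring
  rw [hq, map_div₀, Complex.normSq_mk, Complex.normSq_mk]
  unfold endSiteAlbedo
  rw [abs_of_nonneg hk]
  have hD : (1 - Real.cos k) ^ 2 + (Real.sin k + γ * dispersion ω₂ k) ^ 2 =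
      (Real.cos k - 1) * (Real.cos k - 1) +
        (-Real.sin k - γ * dispersion ω₂ k) * (-Real.sin k - γ * dispersion ω₂ k) := by ring
  have hden' : (Real.cos k - 1) * (Real.cos k - 1) +
      (-Real.sin k - γ * dispersion ω₂ k) * (-Real.sin k - γ * dispersion ω₂ k) ≠ 0 := by
    rw [← hD]; nlinarith
  rw [hD, div_mul_eq_mul_div, mul_div_assoc', div_eq_div_iff hden' hden']
  ring

/-! ### The contact-filtered transmission `α/(2-α)` and the Landauer integrand -/

/-- **Two grey walls in series.** `α_γ/(2 - α_γ) = 2γω|sin k| / (2(1 - cos k) + γ²ω²)`: the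
fraction of the black-body flux transmitted between two walls of albedo `α_γ` across a
collisionless slab (`1/(1/α + 1/α - 1)`, cf. `twoStreamMedium.kineticSlabConductance_of_eq`).
[folklore] -/
theorem transmission_eq {ω₂ γ : ℝ} (hω : 0 < ω₂) (hγ : 0 < γ) (k : ℝ) :
    endSiteAlbedo ω₂ γ k / (2 - endSiteAlbedo ω₂ γ k) =
      2 * γ * dispersion ω₂ k * |Real.sin k| /
        (2 * (1 - Real.cos k) + γ ^ 2 * dispersion ω₂ k ^ 2) := by
  rw [endSiteAlbedo_eq]
  have hωk := dispersion_pos hω k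
  have h1c : 0 ≤ 1 - Real.cos k := by linarith [Real.cos_le_one k]
  have hE : (2 * (1 - Real.cos k) + γ ^ 2 * dispersion ω₂ k ^ 2) ≠ 0 := by positivity
  have hD : (2 * (1 - Real.cos k) + 2 * γ * dispersion ω₂ k * |Real.sin k| +
      γ ^ 2 * dispersion ω₂ k ^ 2) ≠ 0 := by positivity
  have h2 : 2 - 4 * γ * dispersion ω₂ k * |Real.sin k| /
      (2 * (1 - Real.cos k) + 2 * γ * dispersion ω₂ k * |Real.sin k| +
        γ ^ 2 * dispersion ω₂ k ^ 2) =
      2 * (2 * (1 - Real.cos k) + γ ^ 2 * dispersion ω₂ k ^ 2) /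
        (2 * (1 - Real.cos k) + 2 * γ * dispersion ω₂ k * |Real.sin k| +
          γ ^ 2 * dispersion ω₂ k ^ 2) := by
    rw [eq_div_iff hD, sub_mul, div_mul_cancel₀ _ hD]
    ring
  rw [h2, div_div_div_cancel_right₀ hD, div_eq_div_iff (mul_ne_zero two_ne_zero hE) hE]
  ring

/-- **The Landauer integrand in closed form** on the incident half-band `sin k ≥ 0`:
`ω'(k) α_γ(k)/(2 - α_γ(k)) = 2γ sin²k / (2(1+γ²)(1 - cos k) + γ²ω₂)` — `2γ` times the integrand of
Roy–Dhar's (2.6) at `m = k = 1`, `k' = 0`, `k_o = ω₂`. [cite: RoyDhar2008, §2 eq. (2.6)] -/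
theorem groupVelocity_mul_transmission {ω₂ γ : ℝ} (hω : 0 < ω₂) (hγ : 0 < γ) {k : ℝ}
    (hk : 0 ≤ Real.sin k) :
    groupVelocity ω₂ k * (endSiteAlbedo ω₂ γ k / (2 - endSiteAlbedo ω₂ γ k)) =
      2 * γ * Real.sin k ^ 2 / (2 * (1 + γ ^ 2) * (1 - Real.cos k) + γ ^ 2 * ω₂) := by
  rw [transmission_eq hω hγ, groupVelocity, abs_of_nonneg hk]
  have hωk := dispersion_pos hω k
  have h1c := two_mul_one_sub_cos_nonneg k
  have hsq := dispersion_sq hω.le k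
  have hE : (2 * (1 - Real.cos k) + γ ^ 2 * dispersion ω₂ k ^ 2) ≠ 0 := by positivity
  have hF : (2 * (1 + γ ^ 2) * (1 - Real.cos k) + γ ^ 2 * ω₂) ≠ 0 := by
    have : 0 ≤ 1 - Real.cos k := by linarith
    positivity
  rw [div_mul_div_comm, div_eq_div_iff (mul_ne_zero hωk.ne' hE) hF, hsq]
  ring

/-- The same integrand through the decay rate `r = rootR ω₂ γ` of `HarmonicChainFlux.lean`
(`r + r⁻¹ = 2 + λ`, `λ = ω₂γ²/(1+γ²)`): `ω' α/(2-α) = (2γr/(1+γ²)) · sin²k/(1 - 2r cos k + r²)`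
on `sin k ≥ 0`. [folklore] -/
theorem groupVelocity_mul_transmission_eq_rootR {ω₂ γ : ℝ} (hω : 0 < ω₂) (hγ : 0 < γ) {k : ℝ}
    (hk : 0 ≤ Real.sin k) :
    groupVelocity ω₂ k * (endSiteAlbedo ω₂ γ k / (2 - endSiteAlbedo ω₂ γ k)) =
      2 * γ * rootR ω₂ γ / (1 + γ ^ 2) *
        (Real.sin k ^ 2 / (1 - 2 * rootR ω₂ γ * Real.cos k + rootR ω₂ γ ^ 2)) := by
  rw [groupVelocity_mul_transmission hω hγ hk]
  have hr := rootR_pos hω hγ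
  have hri := rootR_add_inv hω hγ
  set r := rootR ω₂ γ with hr'
  have hγ2 : (1 + γ ^ 2) ≠ 0 := by positivity
  -- `1 - 2 r cos k + r² = r (2(1 - cos k) + λ)`
  have hquad : r ^ 2 + 1 = (2 + lamb ω₂ γ) * r := by
    field_simp at hri
    linear_combination hri
  have hden : 1 - 2 * r * Real.cos k + r ^ 2 = r * (2 * (1 - Real.cos k) + lamb ω₂ γ) := by
    linear_combination hquad
  have hlam : (1 + γ ^ 2) * lamb ω₂ γ = ω₂ * γ ^ 2 := by
    unfold lamb; field_simp
  have hF : (2 * (1 + γ ^ 2) * (1 - Real.cos k) + γ ^ 2 * ω₂) ≠ 0 := by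
    have : 0 ≤ 1 - Real.cos k := by linarith [Real.cos_le_one k]
    positivity
  have hG : 2 * (1 - Real.cos k) + lamb ω₂ γ ≠ 0 := by
    have : 0 ≤ 1 - Real.cos k := by linarith [Real.cos_le_one k]
    have := lamb_pos hω hγ
    positivity
  rw [hden, div_mul_div_comm, div_eq_div_iff hF (mul_ne_zero hγ2 (mul_ne_zero hr.ne' hG))]
  linear_combination (2 * γ * r * Real.sin k ^ 2) * hlam

/-! ### The two integrals -/

/-- The algebra behind the primitive of `sin²k/(1 - 2r cos k + r²)` (`s = sin k`, `c = cos k`).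
[folklore] -/
theorem poissonPrimitive_deriv_identity (r s c : ℝ) (hr : r ≠ 0) (hg : 1 - r * c ≠ 0)
    (hsc : s ^ 2 + c ^ 2 = 1) :
    1 / 2 + c / (2 * r) - (1 - r ^ 2) / (2 * r ^ 2) *
        (1 / (1 + (r * s / (1 - r * c)) ^ 2) *
          ((r * c * (1 - r * c) - r * s * (r * s)) / (1 - r * c) ^ 2)) =
      s ^ 2 / (1 - 2 * r * c + r ^ 2) := by
  have hN : r * c * (1 - r * c) - r * s * (r * s) = r * (c - r) := by
    linear_combination (-(r ^ 2)) * hsc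
  have hD : (1 - r * c) ^ 2 + (r * s) ^ 2 = 1 - 2 * r * c + r ^ 2 := by
    linear_combination (r ^ 2) * hsc
  have hDpos : 0 < (1 - r * c) ^ 2 + (r * s) ^ 2 := by positivity
  have hD0 : 1 - 2 * r * c + r ^ 2 ≠ 0 := by rw [← hD]; exact hDpos.ne'
  have step : 1 / (1 + (r * s / (1 - r * c)) ^ 2) *
      ((r * c * (1 - r * c) - r * s * (r * s)) / (1 - r * c) ^ 2) =
        (r * c * (1 - r * c) - r * s * (r * s)) / ((1 - r * c) ^ 2 + (r * s) ^ 2) := by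
    have e1 : 1 + (r * s / (1 - r * c)) ^ 2 = ((1 - r * c) ^ 2 + (r * s) ^ 2) / (1 - r * c) ^ 2 := by
      rw [eq_div_iff (pow_ne_zero 2 hg), div_pow, add_mul, div_mul_cancel₀ _ (pow_ne_zero 2 hg)]
      ring
    rw [e1, one_div_div, div_mul_div_comm, mul_comm ((1 - r * c) ^ 2), mul_div_mul_right _ _
      (pow_ne_zero 2 hg)]
  have hs : s ^ 2 = 1 - c ^ 2 := by linear_combination hsc
  rw [step, hN, hD, hs, ← mul_div_assoc, eq_div_iff hD0, sub_mul, add_mul, div_mul_cancel₀ _ hD0]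
  field_simp
  ring

/-- The explicit primitive: for `0 < |r| < 1`,
`d/dk [k/2 + sin k/(2r) - (1-r²)/(2r²) · arctan(r sin k/(1 - r cos k))] = sin²k/(1 - 2r cos k + r²)`.
[folklore] -/
theorem hasDerivAt_poissonPrimitive {r : ℝ} (hr0 : r ≠ 0) (hr : |r| < 1) (k : ℝ) :
    HasDerivAt (fun k => k / 2 + Real.sin k / (2 * r) -
        (1 - r ^ 2) / (2 * r ^ 2) * Real.arctan (r * Real.sin k / (1 - r * Real.cos k)))
      (Real.sin k ^ 2 / (1 - 2 * r * Real.cos k + r ^ 2)) k := by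
  have hg : 1 - r * Real.cos k ≠ 0 := by
    have h1 : |r * Real.cos k| < 1 := by
      rw [abs_mul]
      calc |r| * |Real.cos k| ≤ |r| * 1 :=
            mul_le_mul_of_nonneg_left (Real.abs_cos_le_one k) (abs_nonneg r)
        _ < 1 := by rw [mul_one]; exact hr
    have h2 := (abs_lt.1 h1).2
    linarith
  have hf : HasDerivAt (fun k => r * Real.sin k) (r * Real.cos k) k :=
    (Real.hasDerivAt_sin k).const_mul r
  have hg' : HasDerivAt (fun k => 1 - r * Real.cos k) (r * Real.sin k) k :=
    (((Real.hasDerivAt_cos k).const_mul r).const_sub 1).congr_deriv (by ring)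
  have h1 := (hf.div hg' hg).arctan
  have h2 := ((hasDerivAt_id' k).div_const 2).add ((Real.hasDerivAt_sin k).div_const (2 * r))
  have h3 := h2.sub (h1.const_mul ((1 - r ^ 2) / (2 * r ^ 2)))
  exact h3.congr_deriv (poissonPrimitive_deriv_identity r (Real.sin k) (Real.cos k) hr0 hg
    (Real.sin_sq_add_cos_sq k))

/-- `1 - 2r cos k + r² > 0` for `|r| < 1`. [folklore] -/
theorem poisson_den_pos {r : ℝ} (hr : |r| < 1) (k : ℝ) : 0 < 1 - 2 * r * Real.cos k + r ^ 2 := by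
  have h1 : |r * Real.cos k| < 1 := by
    rw [abs_mul]
    calc |r| * |Real.cos k| ≤ |r| * 1 :=
          mul_le_mul_of_nonneg_left (Real.abs_cos_le_one k) (abs_nonneg r)
      _ < 1 := by rw [mul_one]; exact hr
  have h2 := (abs_lt.1 h1).2
  have hD : 1 - 2 * r * Real.cos k + r ^ 2 = (1 - r * Real.cos k) ^ 2 + (r * Real.sin k) ^ 2 := by
    linear_combination (-(r ^ 2)) * Real.sin_sq_add_cos_sq k
  rw [hD]
  have : 0 < 1 - r * Real.cos k := by linarith
  positivity

/-- **The Poisson-type integral** `∫₀^π sin²k dk/(1 - 2r cos k + r²) = π/2` for `|r| < 1`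
(independent of `r`: expand `(1 - 2r cos k + r²)⁻¹ = (1-r²)⁻¹(1 + 2∑ rⁿ cos nk)` against
`sin²k = (1 - cos 2k)/2`; proved here from the explicit primitive). [folklore] -/
theorem integral_sin_sq_div_poisson {r : ℝ} (hr : |r| < 1) :
    ∫ k in (0 : ℝ)..π, Real.sin k ^ 2 / (1 - 2 * r * Real.cos k + r ^ 2) = π / 2 := by
  rcases eq_or_ne r 0 with rfl | hr0
  · have h : (fun k => Real.sin k ^ 2 / (1 - 2 * (0 : ℝ) * Real.cos k + (0 : ℝ) ^ 2)) =
        fun k => Real.sin k ^ 2 := by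
      funext k; simp
    rw [h, integral_sin_sq]
    simp
  · have hcont : Continuous fun k => Real.sin k ^ 2 / (1 - 2 * r * Real.cos k + r ^ 2) :=
      Continuous.div (by fun_prop) (by fun_prop) fun k => (poisson_den_pos hr k).ne'
    rw [intervalIntegral.integral_eq_sub_of_hasDerivAt
      (fun k _ => hasDerivAt_poissonPrimitive hr0 hr k) (hcont.intervalIntegrable _ _)]
    simp

/-- **Roy–Dhar's integral** [RoyDhar2008, §2 eq. (2.6), second line]: for `0 < Ω < Λ`,
`∫₀^π sin²q dq/(Λ - Ω cos q) = (π/Ω²)(Λ - √(Λ² - Ω²))`. [cite: RoyDhar2008, §2 eq. (2.6)] -/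
theorem integral_sin_sq_div_sub_mul_cos {Λ Ω : ℝ} (hΩ : 0 < Ω) (hΛ : Ω < Λ) :
    ∫ q in (0 : ℝ)..π, Real.sin q ^ 2 / (Λ - Ω * Real.cos q) =
      π / Ω ^ 2 * (Λ - Real.sqrt (Λ ^ 2 - Ω ^ 2)) := by
  -- `r = (Λ - √(Λ² - Ω²))/Ω ∈ (0,1)` has `Ω(1 + r²) = 2Λr`, so `Λ - Ω cos q = (Ω/2r)(1 - 2r cos q + r²)`
  have hΛ0 : 0 < Λ := hΩ.trans hΛ
  have hsq : Real.sqrt (Λ ^ 2 - Ω ^ 2) ^ 2 = Λ ^ 2 - Ω ^ 2 :=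
    Real.sq_sqrt (by nlinarith)
  have hslt : Real.sqrt (Λ ^ 2 - Ω ^ 2) < Λ := by
    rw [Real.sqrt_lt' hΛ0]; nlinarith
  have hsgt : Λ - Ω < Real.sqrt (Λ ^ 2 - Ω ^ 2) := by
    rw [Real.lt_sqrt (by linarith)]; nlinarith
  set w := Real.sqrt (Λ ^ 2 - Ω ^ 2) with hw
  set r := (Λ - w) / Ω with hr
  have hr0 : 0 < r := by rw [hr]; exact div_pos (by linarith) hΩ
  have hr1 : r < 1 := by rw [hr, div_lt_one hΩ]; linarith
  have hrabs : |r| < 1 := abs_lt.2 ⟨by linarith, hr1⟩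
  have hquad : Ω * (1 + r ^ 2) = 2 * Λ * r := by
    rw [hr]; field_simp; nlinarith [hsq]
  have hden : ∀ q, Λ - Ω * Real.cos q = Ω / (2 * r) * (1 - 2 * r * Real.cos q + r ^ 2) := by
    intro q
    field_simp
    linear_combination (-1 : ℝ) * hquad
  have hcongr : ∫ q in (0 : ℝ)..π, Real.sin q ^ 2 / (Λ - Ω * Real.cos q) =
      ∫ q in (0 : ℝ)..π, 2 * r / Ω * (Real.sin q ^ 2 / (1 - 2 * r * Real.cos q + r ^ 2)) := by
    apply intervalIntegral.integral_congr
    intro q _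
    have hP := (poisson_den_pos hrabs q).ne'
    simp only
    rw [hden q]
    field_simp
  rw [hcongr, intervalIntegral.integral_const_mul, integral_sin_sq_div_poisson hrabs, hr]
  field_simp

/-! ### The Landauer identity -/

/-- **Landauer identity for the end-site albedo.** For `ω₂ > 0`, `γ > 0`,

  `(2π)⁻¹ ∫₀^π ω'(k) · α_γ(k)/(2 - α_γ(k)) dk = fluxLimit ω₂ γ  (= γ r/(2(1+γ²)))`:

the collisionless two-grey-wall slab with the end-site albedo reproduces the PROVED ballistic
conductance `lim_N fluxCoeff ω₂ γ N` of the Rieder–Lebowitz–Lieb–Nakazawa chain `pinnedChain ω₂ 0 0 γ`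
(`tendsto_fluxCoeff`). The left side is Roy–Dhar's (2.6) (`groupVelocity_mul_transmission`), the
right side their (2.8). [cite: RoyDhar2008, §2 eqs. (2.6), (2.8)] -/
theorem landauer_endSiteAlbedo {ω₂ γ : ℝ} (hω : 0 < ω₂) (hγ : 0 < γ) :
    (2 * π)⁻¹ * ∫ k in (0 : ℝ)..π,
        groupVelocity ω₂ k * (endSiteAlbedo ω₂ γ k / (2 - endSiteAlbedo ω₂ γ k)) =
      fluxLimit ω₂ γ := by
  have hr := rootR_pos hω hγ
  have hr1 := rootR_lt_one hω hγ
  have hrabs : |rootR ω₂ γ| < 1 := abs_lt.2 ⟨by linarith, hr1⟩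
  have hcongr : ∫ k in (0 : ℝ)..π,
      groupVelocity ω₂ k * (endSiteAlbedo ω₂ γ k / (2 - endSiteAlbedo ω₂ γ k)) =
        ∫ k in (0 : ℝ)..π, 2 * γ * rootR ω₂ γ / (1 + γ ^ 2) *
          (Real.sin k ^ 2 / (1 - 2 * rootR ω₂ γ * Real.cos k + rootR ω₂ γ ^ 2)) := by
    apply intervalIntegral.integral_congr
    intro k hk
    rw [Set.uIcc_of_le Real.pi_pos.le] at hk
    exact groupVelocity_mul_transmission_eq_rootR hω hγ
      (Real.sin_nonneg_of_nonneg_of_le_pi hk.1 hk.2)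
  rw [hcongr, intervalIntegral.integral_const_mul, integral_sin_sq_div_poisson hrabs]
  unfold fluxLimit
  have hγ2 : (1 + γ ^ 2) ≠ 0 := by positivity
  field_simp

/-- The same identity in Roy–Dhar's variables: the Landauer integral is
`(γ/π) ∫₀^π sin²k dk/(2(1+γ²)(1 - cos k) + γ²ω₂)`. [cite: RoyDhar2008, §2 eq. (2.6)] -/
theorem landauer_endSiteAlbedo_eq_royDhar {ω₂ γ : ℝ} (hω : 0 < ω₂) (hγ : 0 < γ) :
    (2 * π)⁻¹ * ∫ k in (0 : ℝ)..π,
        groupVelocity ω₂ k * (endSiteAlbedo ω₂ γ k / (2 - endSiteAlbedo ω₂ γ k)) =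
      γ / π * ∫ k in (0 : ℝ)..π,
        Real.sin k ^ 2 / (2 * (1 + γ ^ 2) * (1 - Real.cos k) + γ ^ 2 * ω₂) := by
  have hcongr : ∫ k in (0 : ℝ)..π,
      groupVelocity ω₂ k * (endSiteAlbedo ω₂ γ k / (2 - endSiteAlbedo ω₂ γ k)) =
        ∫ k in (0 : ℝ)..π, 2 * γ *
          (Real.sin k ^ 2 / (2 * (1 + γ ^ 2) * (1 - Real.cos k) + γ ^ 2 * ω₂)) := by
    apply intervalIntegral.integral_congr
    intro k hk
    rw [Set.uIcc_of_le Real.pi_pos.le] at hk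
    simp only
    rw [groupVelocity_mul_transmission hω hγ (Real.sin_nonneg_of_nonneg_of_le_pi hk.1 hk.2)]
    ring
  rw [hcongr, intervalIntegral.integral_const_mul]
  have hπ := Real.pi_pos.ne'
  field_simp

/-- **The flux of `pinnedChain ω₂ 0 0 γ` converges to the Landauer integral of its end-site
albedo** (`tendsto_fluxCoeff` rewritten through `landauer_endSiteAlbedo`).
[cite: RoyDhar2008, §2 eqs. (2.6), (2.8)] -/
theorem tendsto_fluxCoeff_landauer {ω₂ γ : ℝ} (hω : 0 < ω₂) (hγ : 0 < γ) :
    Filter.Tendsto (fun N => fluxCoeff ω₂ γ N) Filter.atTop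
      (nhds ((2 * π)⁻¹ * ∫ k in (0 : ℝ)..π,
        groupVelocity ω₂ k * (endSiteAlbedo ω₂ γ k / (2 - endSiteAlbedo ω₂ γ k)))) := by
  rw [landauer_endSiteAlbedo hω hγ]
  exact tendsto_fluxCoeff hω hγ

end Literature.MathematicalPhysics.KineticTheory.PhononBoltzmann
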